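import Literature.NumberTheory.EllipticCurves.CongruenceNumber
import Literature.NumberTheory.EllipticCurves.AtkinLehnerInvolutions
import Literature.NumberTheory.DiophantineGeometry.Conductor
import HarnessLib
import HarnessLib.Audit.Tags

/-!
# Candidates E-desc-26 / E-desc-23 (desc g4, MEMO-desc §21): the ATKIN–LEHNER-STABLE CONGRUENCE LAW
# `ALStableCongruenceLaw` and its corollary the DEPTH LAW `ALStableDepthLaw`, over the tree-only definitions
# `lineIndex`, `alStableLattice`; plus the POSITED interface `NeronFLineDatum` (Néron `f`-line datum) with its proved
# bookkeeping — cell `bsd-f2-manin` (D-0131 (3) frontier: the Manin constant at additive primes).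

HONEST FRAMING. LENS = descent / visibility (planner `bsd-f2-manin-desc` g4; HOME
`run/shared/lean/pub/bsd-f2-manin/MEMO-desc.md` §21 «the Néron side of (††)», §21.10 «the AL cut is EVERYTHING:
r_AL = m_E in 59/59», §21.11 errata). Source: HOME/desc/Sketch-desc-g4.lean sha16 0236df88040921b9 (farm rc 0 · 0
sorries per desc and per refuter-1 §R48) — the definitions `lineIndex`, `alStableLattice`, the two laws, the edge
`alStableDepthLaw_of_congruenceLaw`, the interface `NeronFLineDatum` with `LieSaturatedAt` / `NeronCongruenceDepthAt`
and the proved lemmas `xiStar_eq_of_coord`, `xiStar_val_aux`, `not_dvd_maninConstant_of_depth`,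
`lieSaturatedAt_of_depth` are copied VERBATIM (namespace `DescG4` ↦ the cell leaf namespace; two missing docstrings
added; one docstring sentence reworded per refuter-1 N-desc-g4-1/§21.11 (ii): at `p ∥ N` one has `Λ_p = S^{AL}_p`,
not `Λ_p = S_p`); the lattice API `le_alStableLattice_of_stable`, `alStableLattice_map_le`,
`span_le_alStableLattice`, `f_mem_alStableLattice`, `NeronFLineDatum.Λ_le_alStableLattice` and the COLLAPSE lemmas
`xiStar_self`, `xiStar_self_mul_maninConstant`, `maninConstant_dvd_modularDegree`,
`depthAt_of_not_dvd_of_lieSaturatedAt`, `depthAt_iff` are refuter-1's kernel items RB56.2–56.6, 56.9–56.11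
(HOME/ref1-C56-desc-g4-audit.lean 6056afd31b12cca0, section `RefAudit56`), copied VERBATIM as refuter-1 asked
(«if `NeronFLineDatum` is filed, include RB56.11 `depthAt_iff` and RB56.9′ `maninConstant_dvd_modularDegree`»).
NOT FILED, deliberately (refuter-1 §R48): E-desc-23♯ `ALStableNoCutLaw` (REFUTED by desc's own census: 64a1,
`r_S = 4`, `r_AL = 2`), E-desc-24 `NeronCongruenceDepthLaw` (SURVIVES but COLLAPSES: by `depthAt_iff` its
conclusion is literally «`p ∤ c_E` ∧ Lie saturation at `p`», and it is a corollary row of E-desc-23/26 given its own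
hypotheses; no refutable surface until the constructed datum D-desc-g4-1 exists), the junk models J1/J2 (refuter-1's
evidence that `LieSaturatedAt` / `NeronCongruenceDepthAt` must stay GIVEN-datum predicates, never `∀ Δ`-closed).

THE OBJECTS (tree declarations only). `lineIndex M f = #(M ⧸ (ℤ f + M ∩ f^⊥))` — the `f`-LINE INDEX of a `ℤ`-lattice
of cusp forms (`f^⊥` = kernel of the Petersson pairing with `f`; junk `0` for an infinite quotient, the tree's
`congruenceNumber` convention: `lineIndex (integralCuspForms0 N 2) f = congruenceNumber f` by `rfl`).
`alStableLattice N = sSup {M ≤ S₂(Γ₀(N);ℤ) | w_{Q_p} M ≤ M ∀ p ∣ N}` — the LARGEST Atkin–Lehner-stable sublattice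
`S^{AL}` of the integral `q`-expansion lattice (an honest `Submodule ℤ` supremum; it is itself AL-stable,
`alStableLattice_map_le`; it contains `ℤ f` for the newform of any datum GIVEN the tree's cite-only fact
`IsNewform0.exists_atkinLehnerInvolutionAt_eq_smul` — Knapp, *Elliptic Curves*, Thm. 9.27 (b): `w_{Q_p} f = ±f` —
passed as a hypothesis in `f_mem_alStableLattice`; every informal reading «`f ∈ S^{AL}`» below uses that fact).
THE ROWS. **E-desc-26 `ALStableCongruenceLaw`**: for the `X₀(N)`-optimal curve (lattice clause `Λ_W = c·Λ_f` +
minimal degree among data with the same newform), `[e_f S^{AL} : ℤ f] = deg φ` — the Agashe–Ribet–Stein excess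
`r_E/m_E` is EXACTLY the `f`-line index `[e_f S : e_f S^{AL}]`: all of it is failure of Atkin–Lehner stability of
the `q`-expansion lattice at `∞`. **E-desc-23 `ALStableDepthLaw`** (corollary, edge proved here):
`p^{ord_p deg φ} ∣ [e_f S^{AL} : ℤ f]` at every `p² ∣ N`. WHY THE CELL WANTS THEM (§21.2–21.3, §21.10 «CONSEQUENCE
FOR MANIN»): on the Néron `f`-line `ord_p(c_E) = ord_p(deg φ) − r′ − k` (`r′` = Néron congruence exponent, `k` =
Lie-saturation defect of `E → J₀(N)`); with `Λ ⊆ S^{AL}` (Néron mapping property) and E-desc-26 this becomes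
`ord_p(c_E) = g^{AL}_p − k_p` with `g^{AL}_p := ord_p[e_f S^{AL} : e_f Λ] ≥ 0` a quantity of `J₀(N)` and `f` alone;
so Manin at `p` ⟺ `g^{AL}_p = k_p`, and the purely modular E-desc-28 «`e_f H⁰(𝒥₀(N),Ω¹) = e_f S^{AL}`» would give
Manin at `p` AND Lie saturation for every optimal curve (crux C2 `ManinOddAtFour` stmt-BirchSwinnertonDyer-22967
and C3 stmt-22968, stubs `stub_minimalReducibleResidual` / `stub_cThreeImageResidual` — a re-targeting, not a
closure). The interface lemma `not_dvd_maninConstant_of_depth` is the PROVED half «Néron congruence depth at `p`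
⟹ `p ∤ c`», from the interface axioms alone; `depthAt_iff` states the collapse honestly.
POSITED OBJECT: `NeronFLineDatum W D` is an INTERFACE whose fields are printed facts with cite tags (integrality of
Néron differentials at `∞`, Edixhoven 1991 Prop. 2; AL-stability by the Néron mapping property; `ξ^*` Hecke-
equivariant with multiplicity one, Agashe–Ribet–Stein 2012 §3; `κ·c = deg φ`); the CONSTRUCTION «the datum whose `Λ`
is the true `H⁰(𝒥₀(N), Ω¹)` exists» needs Néron models of `J₀(N)` (absent from Mathlib and the tree) and is desc's
definition request D-desc-g4-1 — existence is NOT a field and is NOT asserted anywhere in this file.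

NOT IN PRINT as statements (desc presearch §21.10, corpus fts + vec AND galaxy; refuter-2 R-desc-8 NOT posted at
filing): Agashe–Ribet–Stein 2012 [corpus: paper-doi-10-1007-978-1-4614-1260-1-2] use Atkin–Lehner involutions only at
`p² ∤ N` (p. 13) and explain `p ∣ r_E/m_E` by failure of multiplicity one (Prop. 2.3) and the ring gap `T ⊆ T″ ⊆ T′`
(Def. 5.1–Rem. 5.7); nobody replaces `S₂(ℤ)` by its AL-stable sublattice; the semistable content (`p ∥ N`) is a
theorem chain (refuter-1 §R48: `S^{AL}` matters only at `p² ∣ N`). Mechanism row E-desc-27 (informal) not typed.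

BC5 WITNESS (cell census of record, RE-COUNTED by the typer 2026-08-28T05:5xZ): HOME/desc/ALNERON-mini-rows-g4.tsv
sha16 1de3e79c2e8f1de8 (desc's engine 0 `alneron_mini.py` 346e6d31762b13f9) · 59 optimal classes at the 23 all-rational
levels `40 ≤ N ≤ 384` with a square factor · **`r_AL = m_E` at 59/59** (violations 0; 31 classes non-vacuous,
`r_S ≠ m_E`, excess up to `x = 3`) · validators V2 59/59, V1 61/61 (theorem-implied). Second engine (PARI, all
newform orbits, `N ≤ 300` + record levels) = D-desc-6, NOT run at filing; refuter-1's sharpest falsifier: same-sign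
NON-rational packets congruent to `f` at `p² ∣ N` (`N ∈ {147, 189, 243, 275, …}`). Beyond-print rows: n/a (a law
about `S₂(Γ₀(N);ℤ)` and `deg φ`; its Manin consequence is conditional on E-desc-28).
REFUTER VERDICTS AT FILING (2026-08-28): REF1 §R48 (R-desc-7): E-desc-23 SURVIVES (CLEAN), E-desc-26 SURVIVES
(typed, satisfiable, non-junk), 23♯ census-dead (not filed), 24 collapses (not filed), 25 predicate-only (kept as the
GIVEN-datum predicate `LieSaturatedAt`); `#h21_crux_probe` CLEAN on all; REF2 R-desc-8 PENDING. A refuter-repaired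
text, if any, lands under a NEW name (suffix `R`) per the tree's append-only rule.
-/

noncomputable section

open scoped MatrixGroups ModularForm

open CongruenceSubgroup WeierstrassCurve Literature.NumberTheory.EllipticCurves.ModularForms
  Literature.NumberTheory.DiophantineGeometry

namespace Summit.BirchSwinnertonDyer.Rank1Residual.ManinAdditive

/-! ### f-line index of a lattice and the AL-stable sublattice (tree declarations only; desc g4 VERBATIM) -/

section Lattices

variable {N : ℕ} [NeZero N]

/-- The **f-line index** `[e_f M : ℤ f]` of a `ℤ`-lattice `M` of cusp forms along `f`:
`#(M ⧸ (ℤ f + M ∩ f^⊥))`, `f^⊥` the Petersson-orthogonal (= Hecke) complement; `0` is the junk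
value for an infinite quotient.  For `M = S₂(Γ₀(N); ℤ)` this is the congruence number `r_f`
(`lineIndex_integralCuspForms0`). (desc g4, Sketch-desc-g4.lean 0236df88040921b9, VERBATIM.) -/
def lineIndex (M : Submodule ℤ (CuspForm (Gamma0 N) 2)) (f : CuspForm (Gamma0 N) 2) : ℕ :=
  Nat.card (M ⧸ ((ℤ ∙ f) ⊔
    (M ⊓ (LinearMap.ker (peterssonProductₗ (Gamma0 N) 2 f)).restrictScalars ℤ)).comap M.subtype)

/-- On the full integral lattice the `f`-line index is the tree's `congruenceNumber f` (definitionally). -/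
theorem lineIndex_integralCuspForms0 (f : CuspForm (Gamma0 N) 2) :
    lineIndex (integralCuspForms0 N 2) f = congruenceNumber f := rfl

variable (N) in
/-- The **Atkin–Lehner-stable sublattice** `S^{AL} ⊆ S₂(Γ₀(N); ℤ)`: the largest `ℤ`-submodule of
the integral `q`-expansion lattice stable under every `w_{Q_p}`, `Q_p = p^{v_p(N)}` (hence under the
whole Atkin–Lehner group).  The Néron lattice `H⁰(𝒥₀(N), Ω¹)` lies inside it (Néron mapping
property for `w_Q ∈ Aut J₀(N)_ℚ` + integrality of Néron differentials at `∞`). (desc g4 VERBATIM.) -/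
def alStableLattice : Submodule ℤ (CuspForm (Gamma0 N) 2) :=
  sSup {M | M ≤ integralCuspForms0 N 2 ∧ ∀ p : ℕ, p.Prime → p ∣ N →
    M.map ((atkinLehnerInvolutionAt N 2 p).restrictScalars ℤ) ≤ M}

/-- `S^{AL}` is integral. (desc g4.) -/
theorem alStableLattice_le : alStableLattice N ≤ integralCuspForms0 N 2 :=
  sSup_le fun _ hM => hM.1

/-- Every AL-stable integral lattice lies in `alStableLattice N` (it IS the `sSup`). (refuter-1 RB56.2.) -/
theorem le_alStableLattice_of_stable {M : Submodule ℤ (CuspForm (Gamma0 N) 2)}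
    (hM : M ≤ integralCuspForms0 N 2)
    (hst : ∀ p : ℕ, p.Prime → p ∣ N →
      M.map ((atkinLehnerInvolutionAt N 2 p).restrictScalars ℤ) ≤ M) :
    M ≤ alStableLattice N :=
  le_sSup ⟨hM, hst⟩

/-- `alStableLattice N` is itself AL-stable (sSup of stable submodules; `map` is monotone and commutes with
`iSup`), so the `sSup` is a MAX. (refuter-1 RB56.3.) -/
theorem alStableLattice_map_le (p : ℕ) (hp : p.Prime) (hpN : p ∣ N) :
    (alStableLattice N).map ((atkinLehnerInvolutionAt N 2 p).restrictScalars ℤ) ≤ alStableLattice N := by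
  rw [Submodule.map_le_iff_le_comap]
  exact sSup_le fun M hM => Submodule.map_le_iff_le_comap.mp ((hM.2 p hp hpN).trans (le_sSup hM))

/-- `ℤ∙f ≤ S^{AL}` for an integral form that is a `±1`-eigenvector of every `w_{Q_p}` (for the newform `D.f` the
hypotheses are `D.f_mem_integralCuspForms0` and the tree FACT `IsNewform0.exists_atkinLehnerInvolutionAt_eq_smul`,
Knapp Thm. 9.27 (b)); so `lineIndex (alStableLattice N) D.f` is computed on a lattice CONTAINING `f`.
(refuter-1 RB56.4.) -/
theorem span_le_alStableLattice {f : CuspForm (Gamma0 N) 2} (hf : f ∈ integralCuspForms0 N 2)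
    (heig : ∀ p : ℕ, p.Prime → p ∣ N →
      ∃ ε : ℂ, (ε = 1 ∨ ε = -1) ∧ atkinLehnerInvolutionAt N 2 p f = ε • f) :
    (ℤ ∙ f) ≤ alStableLattice N := by
  refine le_alStableLattice_of_stable ((Submodule.span_singleton_le_iff_mem _ _).mpr hf) ?_
  intro p hp hpN
  obtain ⟨ε, hε, hw⟩ := heig p hp hpN
  rw [Submodule.map_le_iff_le_comap, Submodule.span_singleton_le_iff_mem, Submodule.mem_comap]
  show atkinLehnerInvolutionAt N 2 p f ∈ ℤ ∙ f
  rw [hw]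
  rcases hε with rfl | rfl
  · rw [one_smul]; exact Submodule.mem_span_singleton_self f
  · rw [neg_one_smul]; exact Submodule.neg_mem _ (Submodule.mem_span_singleton_self f)

/-- The newform of a datum lies in `S^{AL}` GIVEN Knapp 9.27 (b) (tree cite-only FACT
`IsNewform0.exists_atkinLehnerInvolutionAt_eq_smul`, passed as a hypothesis). (refuter-1 RB56.5.) -/
theorem f_mem_alStableLattice {W : WeierstrassCurve ℚ} (D : ModularParametrizationData W N)
    (hAL : IsNewform0.exists_atkinLehnerInvolutionAt_eq_smul (N := N) (k := 2)) :
    D.f ∈ alStableLattice N :=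
  span_le_alStableLattice D.f_mem_integralCuspForms0
    (fun _ hp hpN => hAL D.isNewformOf.1 hp hpN) (Submodule.mem_span_singleton_self D.f)

end Lattices

/-! ### E-desc-23 / E-desc-26: the AL-stable depth and congruence laws (`@[conjecture]`; nothing asserted) -/

/-- **Candidate E-desc-23 `ALStableDepthLaw` (cell bsd-f2-manin, desc g4; nothing asserted).** For the
`X₀(N)`-optimal curve (`c Λ_f = Λ_E`, minimal degree in its class) and every prime `p` with `p² ∣ N`, the AL-stable
sublattice still carries the full modular-degree congruence on the `f`-line: `p^{ord_p(deg φ)} ∣ [e_f S^{AL} : ℤ f]`.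
It follows from (Manin at `p`) ∧ (Lie saturation at `p`); a census row violating it certifies a Lie-saturation defect
`k_p > 0` (given `c_E = 1`). Corollary of E-desc-26 (`alStableDepthLaw_of_congruenceLaw`). VERBATIM
HOME/desc/Sketch-desc-g4.lean 0236df88040921b9 `DescG4.ALStableDepthLaw`. Not in print (Agashe–Ribet–Stein 2012 use
Atkin–Lehner only at `p² ∤ N`; cell memo MEMO-desc §21). -/
@[conjecture]
def ALStableDepthLaw : Prop :=
  ∀ (W : WeierstrassCurve ℚ) [W.IsElliptic] [W.IsGloballyMinimal] [NeZero (W.conductorNorm ℤ)]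
    (D : ModularParametrizationData W (W.conductorNorm ℤ)),
    (∀ z ∈ D.L.lattice, ∃ w ∈ periodLattice D.f, z = D.c * w) →
    (∀ (W' : WeierstrassCurve ℚ) [W'.IsElliptic]
        (D' : ModularParametrizationData W' (W.conductorNorm ℤ)),
        D'.f = D.f → D.modularDegree ≤ D'.modularDegree) →
    ∀ p : ℕ, p.Prime → p ^ 2 ∣ W.conductorNorm ℤ →
      p ^ padicValNat p D.modularDegree ∣ lineIndex (alStableLattice (W.conductorNorm ℤ)) D.f

/-- **Candidate E-desc-26 `ALStableCongruenceLaw` (cell bsd-f2-manin, desc g4; nothing asserted)** — the law the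
in-seat census FOUND (MEMO-desc §21.10; 59/59 optimal classes at the 23 all-rational levels `N ≤ 384` with a square
factor, `p ∈ {2,3,5,7,11}`, `v_p(N) ≤ 7`; validators V1 61/61, V2 59/59): for the `X₀(N)`-optimal curve the `f`-line
index of the AL-stable sublattice IS the modular degree, `[e_f S^{AL} : ℤ f] = deg φ`. Equivalently the
Agashe–Ribet–Stein excess `r_E / m_E` equals `[e_f S : e_f S^{AL}]`: all of it is failure of Atkin–Lehner stability
of the `q`-expansion lattice. With `Λ ⊆ S^{AL}` it turns the `f`-line identity into `ord_p c_E = g^{AL}_p − k_p`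
(`g^{AL} := ord_p r_AL − r′ ≥ 0`), so Manin at `p` ⇔ `g^{AL}_p = k_p`, and `g^{AL}_p = 0 ⇒` Manin. VERBATIM
HOME/desc/Sketch-desc-g4.lean 0236df88040921b9 `DescG4.ALStableCongruenceLaw`. Not in print (semistable shadow:
Agashe–Ribet–Stein 2012 Thm. 2.1; cell memo MEMO-desc §21.10).
[cite: AgasheRibetStein2012, Thm. 2.1, Prop. 2.3, Def. 5.1–Rem. 5.7 (shape only: congruence number vs modular degree; the Atkin–Lehner-stable sublattice law at `p² ∣ N` is NOT in print — cell memo MEMO-desc §21.10, census 59/59)] -/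
@[conjecture]
def ALStableCongruenceLaw : Prop :=
  ∀ (W : WeierstrassCurve ℚ) [W.IsElliptic] [W.IsGloballyMinimal] [NeZero (W.conductorNorm ℤ)]
    (D : ModularParametrizationData W (W.conductorNorm ℤ)),
    (∀ z ∈ D.L.lattice, ∃ w ∈ periodLattice D.f, z = D.c * w) →
    (∀ (W' : WeierstrassCurve ℚ) [W'.IsElliptic]
        (D' : ModularParametrizationData W' (W.conductorNorm ℤ)),
        D'.f = D.f → D.modularDegree ≤ D'.modularDegree) →
    lineIndex (alStableLattice (W.conductorNorm ℤ)) D.f = D.modularDegree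

/-- **Edge E-desc-26 ⟹ E-desc-23**: equality of the index with `deg φ` gives the `p`-power divisibility.
(desc g4, PROVED, VERBATIM.) -/
theorem alStableDepthLaw_of_congruenceLaw (h : ALStableCongruenceLaw) : ALStableDepthLaw := by
  intro W _ _ _ D hL hopt p hp _
  rw [h W D hL hopt]
  exact pow_padicValNat_dvd

/-! ### The posited Néron f-line datum (interface; desc g4 VERBATIM) and its proved bookkeeping -/

/-- **INTERFACE (posited object) `NeronFLineDatum`.**  For a parametrisation datum `D` of level `N`:
`Λ` = the `q`-expansions at `∞` of `H⁰(𝒥₀(N), Ω¹)` with its printed properties —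
integral [cite: EdixhovenManin1991, Prop. 2], Atkin–Lehner stable (Néron mapping property),
and the pull-back `ξ^* : Λ → H⁰(𝓔, Ω¹) = ℤ ω` along `ξ = π^∨`, which by Hecke-equivariance and
multiplicity one [cite: AgasheRibetStein2012, §3] is `g ↦ κ ⟨f, g⟩/⟨f, f⟩` for one `κ ∈ ℚ` with
`κ · c = deg φ` (`ξ^* π^* = [deg φ]^*`, `π^* ω = c ω_f`).  The CONSTRUCTION statement («the datum
with `Λ` = the true Néron lattice exists for every `D`») is definition request D-desc-g4-1 and is
NOT a field: existence is never smuggled into the interface. Inhabited with NO Néron input (refuter-1 RB56.14: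
`Λ = ⊥`, `ξ^* = 0`), which is why `LieSaturatedAt` / `NeronCongruenceDepthAt` are GIVEN-datum predicates only. -/
structure NeronFLineDatum {N : ℕ} [NeZero N] (W : WeierstrassCurve ℚ) [W.IsElliptic]
    (D : ModularParametrizationData W N) where
  /-- `Λ ⊆ S₂(Γ₀(N))`: `q`-expansions of the Néron differentials of `J₀(N)`. -/
  Λ : Submodule ℤ (CuspForm (Gamma0 N) 2)
  /-- Néron differentials have integral `q`-expansion at `∞`. [cite: EdixhovenManin1991, Prop. 2] -/
  Λ_le : Λ ≤ integralCuspForms0 N 2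
  /-- `Λ` is stable under every Atkin–Lehner involution `w_{Q_p}`. [folklore] -/
  map_atkinLehner_le : ∀ p : ℕ, p.Prime → p ∣ N →
    Λ.map ((atkinLehnerInvolutionAt N 2 p).restrictScalars ℤ) ≤ Λ
  /-- `ξ^*` on Néron differentials, valued in `H⁰(𝓔, Ω¹) = ℤ ω`. [folklore] -/
  xiStar : Λ →ₗ[ℤ] ℤ
  /-- The scalar `κ` with `ξ^*_ℚ(ω_f) = κ ω`. -/
  κ : ℚ
  /-- `ξ^*(g) ⟨f, f⟩ = κ ⟨f, g⟩` (Hecke-equivariance of `ξ^*`, multiplicity one).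
  [cite: AgasheRibetStein2012, §3] -/
  xiStar_mul : ∀ g : Λ, (xiStar g : ℂ) * peterssonProduct (Gamma0 N) 2 D.f D.f =
    (κ : ℂ) * peterssonProduct (Gamma0 N) 2 D.f (g : CuspForm (Gamma0 N) 2)
  /-- `κ · c = deg φ` (`π ∘ ξ = [deg φ]`, `π^* ω = c ω_f`). [folklore] -/
  κ_mul_maninConstant : κ * D.maninConstant = D.modularDegree
  /-- `⟨f, f⟩ ≠ 0` (`f ≠ 0`, Petersson product positive definite). [folklore] -/
  petersson_self_ne_zero : peterssonProduct (Gamma0 N) 2 D.f D.f ≠ 0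

namespace NeronFLineDatum

variable {N : ℕ} [NeZero N] {W : WeierstrassCurve ℚ} [W.IsElliptic]
  {D : ModularParametrizationData W N} (Δ : NeronFLineDatum W D)

/-- `r_Λ = [e_f Λ : ℤ f]`, the NÉRON CONGRUENCE NUMBER of `f` (its `p`-adic valuation is `r'_p`). (desc g4.) -/
def neronCongruenceNumber : ℕ := lineIndex Δ.Λ D.f

/-- `#coker(ξ^* : Λ → ℤ ω)`, the LIE-SATURATION DEFECT (its `p`-adic valuation is `k_p`; junk `0`
if `ξ^* = 0`). (desc g4.) -/
def lieSaturationIndex : ℕ := Nat.card (ℤ ⧸ LinearMap.range Δ.xiStar)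

/-- **L1_p `LieSaturatedAt p`** (E-desc-25, a GIVEN-datum predicate): `ξ^* ⊗ ℤ_(p)` is onto, i.e. some Néron
differential of `J₀(N)` pulls back to a `p`-adic unit multiple of `ω` (equivalently `Lie 𝓔 → Lie 𝒥` has
`p`-saturated image).  Known for `p ∥ N` (Mazur 1978; BLR 7.5/4), OPEN for `p² ∣ N`. (desc g4.) -/
def LieSaturatedAt (p : ℕ) : Prop := ∃ g : Δ.Λ, ¬ (p : ℤ) ∣ Δ.xiStar g

/-- **L2_p `NeronCongruenceDepthAt p`**: some Néron differential has `f`-component `u · f / p^{ord_p(deg φ)}` with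
`u` a `p`-adic unit: the modular-degree congruence is REALISED INSIDE the Néron lattice.  (For `p ∥ N` this holds by
`Λ_p = S^{AL}_p` — Deligne–Rapoport + the Néron extension of `w_Q` — and Agashe–Ribet–Stein 2012 Thm. 2.1 on the
`f`-line; MEMO-desc §21.11 (ii): `Λ_p ⊊ S_p` can happen already at `p ∥ N`.) By `depthAt_iff` below it is EXACTLY
«`p ∤ c_E` ∧ `LieSaturatedAt p`». (desc g4; one docstring sentence reworded per refuter-1 §R48.) -/
def NeronCongruenceDepthAt (p : ℕ) : Prop :=
  ∃ g : Δ.Λ, ∃ q : ℚ, q ≠ 0 ∧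
    (q : ℂ) * peterssonProduct (Gamma0 N) 2 D.f D.f = peterssonProduct (Gamma0 N) 2 D.f g ∧
    padicValRat p q = -(padicValNat p D.modularDegree : ℤ)

/-- Every datum's `Λ` lies in `S^{AL}` (maximality): `e_f Λ ⊆ e_f S^{AL}`. (refuter-1 RB56.6.) -/
theorem Λ_le_alStableLattice : Δ.Λ ≤ alStableLattice N :=
  le_alStableLattice_of_stable Δ.Λ_le Δ.map_atkinLehner_le

/-- The f-coordinate identity behind everything: for `g ∈ Λ` with `⟨f, g⟩ = q ⟨f, f⟩`, `ξ^*(g) = κ q`. (desc g4.) -/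
theorem xiStar_eq_of_coord {g : Δ.Λ} {q : ℚ}
    (hq : (q : ℂ) * peterssonProduct (Gamma0 N) 2 D.f D.f = peterssonProduct (Gamma0 N) 2 D.f g) :
    (Δ.xiStar g : ℚ) = Δ.κ * q := by
  have h := Δ.xiStar_mul g
  rw [← hq, ← mul_assoc] at h
  have h' : ((Δ.xiStar g : ℚ) : ℂ) = ((Δ.κ * q : ℚ) : ℂ) := by
    push_cast
    exact mul_right_cancel₀ Δ.petersson_self_ne_zero (by exact_mod_cast h)
  exact_mod_cast h'

/-- Valuation bookkeeping on the `f`-line: for `g ∈ Λ` with `f`-coordinate `q`, `ord_p ξ^*(g) = −ord_p(c)` when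
`ord_p(q) = −ord_p(deg φ)`. (desc g4.) -/
theorem xiStar_val_aux {p : ℕ} [hp : Fact p.Prime] {g : Δ.Λ} {q : ℚ} (hq0 : q ≠ 0)
    (hq : (q : ℂ) * peterssonProduct (Gamma0 N) 2 D.f D.f = peterssonProduct (Gamma0 N) 2 D.f g)
    (hval : padicValRat p q = -(padicValNat p D.modularDegree : ℤ)) :
    Δ.xiStar g ≠ 0 ∧ D.maninConstant ≠ 0 ∧
      (padicValInt p (Δ.xiStar g) : ℤ) = -(padicValInt p D.maninConstant : ℤ) := by
  have hdeg : (D.modularDegree : ℚ) ≠ 0 := by exact_mod_cast D.deg_pos.ne'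
  have hκc := Δ.κ_mul_maninConstant
  have hc : (D.maninConstant : ℚ) ≠ 0 := by
    intro h0; rw [h0, mul_zero] at hκc; exact hdeg hκc.symm
  have hκ : Δ.κ = D.modularDegree / D.maninConstant := by rw [eq_div_iff hc]; exact hκc
  have hx : (Δ.xiStar g : ℚ) = D.modularDegree / D.maninConstant * q := by
    rw [← hκ]; exact Δ.xiStar_eq_of_coord hq
  have hxne : (Δ.xiStar g : ℚ) ≠ 0 := by
    rw [hx]; exact mul_ne_zero (div_ne_zero hdeg hc) hq0
  have hxz : Δ.xiStar g ≠ 0 := by exact_mod_cast hxne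
  have hcz : D.maninConstant ≠ 0 := by exact_mod_cast hc
  refine ⟨hxz, hcz, ?_⟩
  have h1 : padicValRat p (Δ.xiStar g : ℚ) = padicValRat p (D.modularDegree : ℚ)
      - padicValRat p (D.maninConstant : ℚ) + padicValRat p q := by
    rw [hx, padicValRat.mul (div_ne_zero hdeg hc) hq0, padicValRat.div hdeg hc]
  rw [padicValRat.of_int, padicValRat.of_int, padicValRat.of_nat, hval] at h1
  linarith

/-- **L2 ⇒ Manin at p** (PROVED from the interface axioms; no Néron-model input beyond the fields): Néron
congruence depth at `p` forces `p ∤ c`.  Proof: `ξ^*(g) = κ q = (deg φ / c) · q ∈ ℤ` with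
`ord_p(q) = −ord_p(deg φ)`, so `ord_p(c) ≤ 0`. (desc g4.) -/
theorem not_dvd_maninConstant_of_depth {p : ℕ} [hp : Fact p.Prime]
    (h : Δ.NeronCongruenceDepthAt p) : ¬ (p : ℤ) ∣ D.maninConstant := by
  obtain ⟨g, q, hq0, hq, hval⟩ := h
  obtain ⟨_, hcz, hv⟩ := Δ.xiStar_val_aux hq0 hq hval
  intro hdvd
  rcases (padicValInt_dvd_iff 1 D.maninConstant).mp (by simpa using hdvd) with h0 | h1
  · exact hcz h0
  · omega

/-- **L2 ⇒ L1** (PROVED): depth forces Lie saturation at `p`. (desc g4.) -/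
theorem lieSaturatedAt_of_depth {p : ℕ} [hp : Fact p.Prime]
    (h : Δ.NeronCongruenceDepthAt p) : Δ.LieSaturatedAt p := by
  obtain ⟨g, q, hq0, hq, hval⟩ := h
  obtain ⟨hxz, _, hv⟩ := Δ.xiStar_val_aux hq0 hq hval
  refine ⟨g, fun hdvd => ?_⟩
  rcases (padicValInt_dvd_iff 1 (Δ.xiStar g)).mp (by simpa using hdvd) with h0 | h1
  · exact hxz h0
  · omega

/-- If `f ∈ Λ` then `κ = ξ^*(f) ∈ ℤ`. (refuter-1 RB56.9.) -/
theorem xiStar_self (h : D.f ∈ Δ.Λ) : ((Δ.xiStar ⟨D.f, h⟩ : ℤ) : ℚ) = Δ.κ := by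
  have := Δ.xiStar_eq_of_coord (g := ⟨D.f, h⟩) (q := 1) (by push_cast; rw [one_mul])
  rw [this, mul_one]

/-- … hence `ξ^*(f) · c = deg φ` in `ℤ`. (refuter-1 RB56.9′.) -/
theorem xiStar_self_mul_maninConstant (h : D.f ∈ Δ.Λ) :
    Δ.xiStar ⟨D.f, h⟩ * D.maninConstant = D.modularDegree := by
  have h1 := Δ.xiStar_self h
  have h2 := Δ.κ_mul_maninConstant
  rw [← h1] at h2
  exact_mod_cast h2

/-- On any datum containing `f`, **`c ∣ deg φ`** (the shape of Česnavičius–Neururer–Saha's `c ∣ deg φ`, obtained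
there from `ω_f ∈ H⁰(X₀(N), Ω)` + rational singularities). (refuter-1 RB56.9′.) -/
theorem maninConstant_dvd_modularDegree (h : D.f ∈ Δ.Λ) : D.maninConstant ∣ (D.modularDegree : ℤ) :=
  ⟨Δ.xiStar ⟨D.f, h⟩, by rw [mul_comm]; exact (Δ.xiStar_self_mul_maninConstant h).symm⟩

/-- Converse of desc's two lemmas (interface axioms only): `p ∤ c` and Lie saturation at `p` GIVE the depth
witness `q = ξ^*(g)/κ`. (refuter-1 RB56.10.) -/
theorem depthAt_of_not_dvd_of_lieSaturatedAt {p : ℕ} [hp : Fact p.Prime]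
    (hc : ¬ (p : ℤ) ∣ D.maninConstant) (hL : Δ.LieSaturatedAt p) :
    Δ.NeronCongruenceDepthAt p := by
  obtain ⟨g, hg⟩ := hL
  have hdeg : (D.modularDegree : ℚ) ≠ 0 := by exact_mod_cast D.deg_pos.ne'
  have hκc := Δ.κ_mul_maninConstant
  have hc0 : (D.maninConstant : ℚ) ≠ 0 := by
    intro h0; rw [h0, mul_zero] at hκc; exact hdeg hκc.symm
  have hκ0 : Δ.κ ≠ 0 := by
    intro h0; rw [h0, zero_mul] at hκc; exact hdeg hκc.symm
  have hx0 : Δ.xiStar g ≠ 0 := fun h0 => hg (h0 ▸ dvd_zero _)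
  refine ⟨g, (Δ.xiStar g : ℚ) / Δ.κ, div_ne_zero (by exact_mod_cast hx0) hκ0, ?_, ?_⟩
  · have h := Δ.xiStar_mul g
    have hκC : ((Δ.κ : ℚ) : ℂ) ≠ 0 := by exact_mod_cast hκ0
    push_cast
    rw [div_mul_eq_mul_div, div_eq_iff hκC, h, mul_comm]
  · have hκ : Δ.κ = D.modularDegree / D.maninConstant := by rw [eq_div_iff hc0]; exact hκc
    rw [padicValRat.div (by exact_mod_cast hx0) hκ0, padicValRat.of_int,
      padicValInt.eq_zero_of_not_dvd hg, hκ, padicValRat.div hdeg hc0, padicValRat.of_int,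
      padicValInt.eq_zero_of_not_dvd hc, ← padicValRat_of_nat]
    push_cast
    ring

/-- **COLLAPSE** (refuter-1 RB56.11, kernel): `L2_p ⟺ (p ∤ c_E) ∧ L1_p` — the conclusion of desc's E-desc-24 is
literally «Manin at `p` ∧ Lie saturation at `p`». -/
theorem depthAt_iff {p : ℕ} [Fact p.Prime] :
    Δ.NeronCongruenceDepthAt p ↔ ¬ (p : ℤ) ∣ D.maninConstant ∧ Δ.LieSaturatedAt p :=
  ⟨fun h => ⟨Δ.not_dvd_maninConstant_of_depth h, Δ.lieSaturatedAt_of_depth h⟩,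
   fun h => Δ.depthAt_of_not_dvd_of_lieSaturatedAt h.1 h.2⟩

end NeronFLineDatum

end Summit.BirchSwinnertonDyer.Rank1Residual.ManinAdditive

end
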